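import Mathlib.Algebra.Order.Archimedean.Basic
import Literature.AlgebraicGeometry.Frobenioids.MonoidTransport
import Literature.IUT.HodgeArakelov.GlobalGaussianRealifiedBridge

/-!
# [IUTchIII] Proposition 3.7 (iii), (iv) at the divisor-monoid level: the global realified LGP- and
# lgp-Frobenioids `†𝒞^⊩_LGP`, `†𝒞^⊩_lgp` of the initial Θ-data, `Prime(−) ⥲ V_mod`, and the tautological
# isomorphisms `†𝔉^⊩_gau ⥲ †𝔉^⊩_LGP ⥲ †𝔉^⊩_lgp` (abc-iut cell, layer L6, DISCHARGE-L6 §F row F10-b)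

S. Mochizuki, *Inter-universal Teichmüller theory III*, kurims manuscript (May 2020), §3, Proposition 3.7
(iii), (iv), pp. 110–111 [claim: Mochizuki2012, status: disputed] (PRIMS **57** (2021), offset ≈ +420).
Printed text. (iii) "By applying the composites of the isomorphisms of Frobenioids
«`†𝒞^⊩_j ⥲ (†𝓕⊛ℝ_mod)_j`» of [IUTchII], Corollary 4.8, (iii), with the realifications
«`(†𝓕⊛ℝ_mod)_α ⥲ (†𝓕⊛ℝ_MOD)_α`» of the isomorphisms of Frobenioids of (i) above to the global realified
Frobenioid portion `†𝒞^⊩_gau` of the `𝓕^⊩`-prime-strip `†𝔉^⊩_gau` of [IUTchII], Corollary 4.10, (ii) …, one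
obtains … `†𝒞^⊩_LGP` [and] an `𝓕^⊩`-prime-strip `†𝔉^⊩_LGP = (†𝒞^⊩_LGP, Prime(†𝒞^⊩_LGP) ⥲ V̲, †𝔉^⊢_LGP,
{†ρ_{LGP,v}}_{v∈V̲})` … together with a natural isomorphism `†𝔉^⊩_gau ⥲ †𝔉^⊩_LGP` … [that arises
tautologically …]." (iv) "by replacing, in the construction of (iii), the isomorphisms
«`(†𝓕⊛ℝ_mod)_α ⥲ (†𝓕⊛ℝ_MOD)_α`» by the natural isomorphisms «`(†𝓕⊛ℝ_mod)_α ⥲ (†𝓕⊛ℝ_𝔪𝔬𝔡)_α`» [cf. (ii)],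
one obtains … `†𝒞^⊩_lgp` … `†𝔉^⊩_lgp` … together with tautological isomorphisms
`†𝔉^⊩_gau ⥲ †𝔉^⊩_LGP ⥲ †𝔉^⊩_lgp`."

LEVEL OF THIS FILE (honest framing). The tree types the realified global Frobenioids of the initial Θ-data
REAL at the level of their DIVISOR MONOIDS, in fixed coordinates: abc-iut-L5-t2's
`Literature.IUT.HodgeTheaters.InitialThetaData.PhiMod` (`Φ_{𝒞⊩_mod} =` finitely supported `V_mod → ℝ≥0`,
[IUTchI] Ex. 3.5) with the local comparison maps `ρ_w` (`InitialThetaData.rho`), and abc-iut-L6-t2's bridge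
`Literature.IUT.HodgeArakelov.phiGau` (`Φ_{𝒞⊩_gau}` = the weighted diagonal `(1²·φ, …, (l⋆)²·φ)` in
`∏_{j∈𝔽_l^⋇} Φ_{𝒞⊩_mod,j}`, [IUTchII] Cor. 4.5 (v) / 4.10 (ii)) with `thtToGau`, `rho_thtToGau`. At that level
this file CONSTRUCTS the (iii)/(iv) objects as print says — applying to `Φ_{𝒞⊩_gau}` the product of the
divisor-level realifications of `(†𝓕⊛_mod)_j ⥲ (†𝓕⊛_MOD)_j`, resp. `⥲ (†𝓕⊛_𝔪𝔬𝔡)_j`, which "induce the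
tautological isomorphisms on the associated rational function monoids" (p. 110) and hence are identities on
divisor monoids written in the SAME coordinates (recorded as definitions `modToMODRlf`, `modToFrakRlf`, not
hidden) — and PROVES the printed clauses that have a kernel statement there: **`Prime(†𝒞^⊩_LGP) ⥲ V_mod`**
(primes in the sense of [FrdI] §0, the tree's `Literature.AlgebraicGeometry.Frobenioids.Primes`; `V̲ ⥲ V_mod`
is [IUTchI] Def. 3.1 (e)), the tautological isomorphisms `gau ⥲ LGP ⥲ lgp`, their compatibility with the
`ρ_w` (weights `j²`), the commutative square / injective realified product embeddings of Prop. 3.7 (v)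
restricted to (iii)/(iv). GENERIC lemma on the way: `FinsuppNNReal.primesEquiv : Prime(ι →₀ ℝ≥0) ≃ ι`.
NOT here: the Frobenioids `(†𝓕⊛_MOD)_j`, `(†𝓕⊛_𝔪𝔬𝔡)_j` as categories (abc-iut-L6-t4 `GlobalFrobenioidModels`,
abc-iut-L6-t6 `FrakCat`), the categorical `†𝒞^⊩_LGP`, `†𝒞^⊩_lgp` and realification functors ([FrdI] Prop.
5.3, layer L1) — the layer's open «Prop. 3.7 NEEDS» item; the `𝓕^⊢`-prime-strips `†𝔉^⊢_LGP = Ψ_{𝓕_LGP}(†𝓗𝓣)`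
(Prop. 3.4 (ii), abc-iut-L6-t4 `LGPMonoidSignature`) are not re-typed. Nothing here asserts a disputed
claim or takes a side on [IUTchIII] Cor. 3.12; typed ≠ discharged; instantiated ≠ endorsed.
-/

noncomputable section

namespace Literature.IUT.LogThetaLattice

open Literature.AlgebraicGeometry.Frobenioids Literature.IUT.HodgeArakelov Literature.IUT.HodgeTheaters
open scoped NNReal Literature.AlgebraicGeometry.Frobenioids

universe u v w

/-! ### 1. Primes of a free `ℝ≥0`-module (generic; [FrdI] §0 "Prime(M)") -/

namespace FinsuppNNReal

variable {ι : Type u}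

/-- Divisibility in `ι →₀ ℝ≥0` (written multiplicatively) is the pointwise order. [cite: MochizukiFrdI2008, §0 p.12] -/
theorem ofAdd_dvd_ofAdd_iff {a b : ι →₀ ℝ≥0} :
    Multiplicative.ofAdd a ∣ Multiplicative.ofAdd b ↔ a ≤ b := by
  constructor
  · rintro ⟨c, hc⟩
    have hc' : b = a + Multiplicative.toAdd c := by
      have := congrArg Multiplicative.toAdd hc
      simpa using this
    rw [hc']
    exact le_self_add
  · intro h
    refine ⟨Multiplicative.ofAdd (b - a), ?_⟩
    rw [← ofAdd_add, add_tsub_cancel_of_le h]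

/-- `a ≼ b` in `ι →₀ ℝ≥0` iff `supp a ⊆ supp b` ([FrdI] §0: `a ≼ b` iff `a ≤ n·b` for some `n ≥ 1`).
[cite: MochizukiFrdI2008, §0 p.12] -/
theorem precsim_iff_support_subset {a b : ι →₀ ℝ≥0} :
    Multiplicative.ofAdd a ≼ Multiplicative.ofAdd b ↔ a.support ⊆ b.support := by
  classical
  constructor
  · rintro ⟨n, -, hdvd⟩
    rw [← ofAdd_nsmul, ofAdd_dvd_ofAdd_iff] at hdvd
    intro i hi
    rw [Finsupp.mem_support_iff] at hi ⊢
    intro hb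
    have h := hdvd i
    rw [Finsupp.smul_apply, hb, smul_zero, nonpos_iff_eq_zero] at h
    exact hi h
  · intro h
    have hb : ∀ i ∈ a.support, 0 < b i := fun i hi =>
      pos_iff_ne_zero.2 (Finsupp.mem_support_iff.1 (h hi))
    choose! n hn using fun i (hi : i ∈ a.support) => Archimedean.arch (a i) (hb i hi)
    refine ⟨a.support.sup n + 1, Nat.succ_pos _, ?_⟩
    rw [← ofAdd_nsmul, ofAdd_dvd_ofAdd_iff]
    intro i
    rw [Finsupp.smul_apply]
    by_cases hi : i ∈ a.support
    · calc a i ≤ n i • b i := hn i hi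
        _ ≤ (a.support.sup n + 1) • b i :=
          nsmul_le_nsmul_left zero_le ((Finset.le_sup hi).trans (Nat.le_succ _))
    · rw [Finsupp.notMem_support_iff.1 hi]
      exact zero_le

/-- A primary element of `ι →₀ ℝ≥0` is supported at exactly one index ([FrdI] §0 "primary": every nonzero
`b ≼ a` satisfies `a ≼ b`). [cite: MochizukiFrdI2008, §0 p.12] -/
theorem isPrimary_iff {a : ι →₀ ℝ≥0} :
    IsPrimary (Multiplicative.ofAdd a) ↔ ∃ i, a.support = {i} := by
  classical
  constructor
  · rintro ⟨ha, hprim⟩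
    have ha' : a ≠ 0 := fun h => ha (by rw [h]; rfl)
    obtain ⟨i, hi⟩ := Finsupp.support_nonempty_iff.2 ha'
    refine ⟨i, Finset.Subset.antisymm ?_ (Finset.singleton_subset_iff.2 hi)⟩
    have hδ : Multiplicative.ofAdd (Finsupp.single i (1 : ℝ≥0)) ≼ Multiplicative.ofAdd a := by
      rw [precsim_iff_support_subset, Finsupp.support_single _ one_ne_zero]
      exact Finset.singleton_subset_iff.2 hi
    have h := hprim (Multiplicative.ofAdd (Finsupp.single i (1 : ℝ≥0)))
      (fun h => (Finsupp.single_ne_zero.2 one_ne_zero : Finsupp.single i (1 : ℝ≥0) ≠ 0)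
        (by simpa using congrArg Multiplicative.toAdd h)) hδ
    rw [precsim_iff_support_subset, Finsupp.support_single _ one_ne_zero] at h
    exact h
  · rintro ⟨i, hi⟩
    refine ⟨fun h => ?_, fun b hb hba => ?_⟩
    · have : a = 0 := by simpa using congrArg Multiplicative.toAdd h
      rw [this, Finsupp.support_zero] at hi
      exact Finset.ne_empty_of_mem (Finset.mem_singleton_self i) hi.symm
    · have hb' : Multiplicative.toAdd b ≠ 0 := fun h => hb (by
        rw [← ofAdd_toAdd b, h]; rfl)
      have hsub : (Multiplicative.toAdd b).support ⊆ {i} := by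
        rw [← hi]; exact precsim_iff_support_subset.1 hba
      obtain ⟨j, hj⟩ := Finsupp.support_nonempty_iff.2 hb'
      have hji : j = i := Finset.mem_singleton.1 (hsub hj)
      change Multiplicative.ofAdd a ≼ Multiplicative.ofAdd (Multiplicative.toAdd b)
      rw [precsim_iff_support_subset, hi, Finset.singleton_subset_iff, ← hji]
      exact hj

/-- `δ_i` is primary. [cite: MochizukiFrdI2008, §0 p.12] -/
theorem isPrimary_single (i : ι) : IsPrimary (Multiplicative.ofAdd (Finsupp.single i (1 : ℝ≥0))) :=
  isPrimary_iff.2 ⟨i, Finsupp.support_single _ one_ne_zero⟩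

/-- The index supporting a primary element. [cite: MochizukiFrdI2008, §0 p.12] -/
def suppPt (a : ι →₀ ℝ≥0) (ha : IsPrimary (Multiplicative.ofAdd a)) : ι :=
  Classical.choose (isPrimary_iff.1 ha)

/-- Defining property of `suppPt`. [cite: MochizukiFrdI2008, §0 p.12] -/
theorem support_eq_suppPt (a : ι →₀ ℝ≥0) (ha : IsPrimary (Multiplicative.ofAdd a)) :
    a.support = {suppPt a ha} :=
  Classical.choose_spec (isPrimary_iff.1 ha)

/-- `≼`-equivalent primary elements are supported at the same index. [cite: MochizukiFrdI2008, §0 p.12] -/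
theorem suppPt_eq_of_precsim {a b : ι →₀ ℝ≥0} (ha : IsPrimary (Multiplicative.ofAdd a))
    (hb : IsPrimary (Multiplicative.ofAdd b)) (h : Multiplicative.ofAdd a ≼ Multiplicative.ofAdd b) :
    suppPt a ha = suppPt b hb := by
  have hsub := precsim_iff_support_subset.1 h
  rw [support_eq_suppPt a ha, support_eq_suppPt b hb, Finset.singleton_subset_iff,
    Finset.mem_singleton] at hsub
  exact hsub

/-- **`Prime(ι →₀ ℝ≥0) ≃ ι`**: the primes ([FrdI] §0: `≼`-classes of primary elements) of the free `ℝ≥0`-module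
on `ι` are in canonical bijection with `ι` — the class of `a` ↦ the unique index in its support, `i ↦` the class
of `δ_i` (the divisor-monoid form of "`Prime(−) ⥲ V`" for a realified global Frobenioid whose divisor monoid
is `⊕_{v ∈ V} ℝ≥0`, [IUTchI] Ex. 3.5 (i) / [FrdI] Ex. 6.3). [cite: MochizukiFrdI2008, §0 p.12] -/
def primesEquiv : Primes (Multiplicative (ι →₀ ℝ≥0)) ≃ ι where
  toFun := Quotient.lift (fun a : primaries (Multiplicative (ι →₀ ℝ≥0)) =>
      suppPt (Multiplicative.toAdd (a : Multiplicative (ι →₀ ℝ≥0))) a.2)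
    (fun a b hab => suppPt_eq_of_precsim a.2 b.2 hab)
  invFun i := Quotient.mk (primarySetoid _) ⟨Multiplicative.ofAdd (Finsupp.single i 1), isPrimary_single i⟩
  left_inv 𝔭 := by
    induction 𝔭 using Quotient.inductionOn with
    | h a =>
      apply Quotient.sound
      change Multiplicative.ofAdd (Finsupp.single _ (1 : ℝ≥0)) ≼ (a : Multiplicative (ι →₀ ℝ≥0))
      rw [← ofAdd_toAdd (a : Multiplicative (ι →₀ ℝ≥0)), precsim_iff_support_subset,
        Finsupp.support_single _ one_ne_zero,
        support_eq_suppPt (Multiplicative.toAdd (a : Multiplicative (ι →₀ ℝ≥0))) a.2]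
      exact Finset.Subset.refl _
  right_inv i := by
    change suppPt (Finsupp.single i 1) (isPrimary_single i) = i
    have h := support_eq_suppPt (Finsupp.single i (1 : ℝ≥0)) (isPrimary_single i)
    rw [Finsupp.support_single _ one_ne_zero, Finset.singleton_inj] at h
    exact h.symm

/-- `primesEquiv` sends the class of `δ_i` to `i`. [cite: MochizukiFrdI2008, §0 p.12] -/
@[simp] theorem primesEquiv_mk_single (i : ι) :
    primesEquiv (Quotient.mk (primarySetoid _)
      ⟨Multiplicative.ofAdd (Finsupp.single i (1 : ℝ≥0)), isPrimary_single i⟩) = i :=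
  primesEquiv.right_inv i

end FinsuppNNReal

/-! ### 2. Proposition 3.7 (iii): `†𝒞^⊩_LGP` and `†𝔉^⊩_gau ⥲ †𝔉^⊩_LGP` at divisor level -/

section Prop37

variable {F : Type u} {K : Type v} {Fbar : Type w} [Field F] [NumberField F] [Field K]
  [NumberField K] [Algebra F K] [Field Fbar] [Algebra F Fbar] [Algebra K Fbar]
  {E : WeierstrassCurve F} [E.IsElliptic] {l : ℕ} {P : BadPlacePredicates K}
  (D : InitialThetaData F K Fbar E l P)

/-- **IUTchIII:Prop3.7(iii)** (kurims p. 110) The divisor monoid of the realification `(†𝓕⊛ℝ_MOD)_j` of the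
Frobenioid `(†𝓕⊛_MOD)_j` of Prop. 3.7 (i) ([IUTchIII] Ex. 3.6 (i); number field `(†𝕄⊛_MOD)_j ≅ F_mod`), in the
coordinates of [IUTchI] Ex. 3.5 (i): finitely supported `V_mod → ℝ≥0` — the SAME monoid as `Φ_{𝒞⊩_mod}`
(`InitialThetaData.PhiMod`), one copy per label `j ∈ 𝔽_l^⋇`. [claim: Mochizuki2012, status: disputed] -/
abbrev PhiMODRlf (_j : Fin (lStar l)) : Type u := D.PhiMod

/-- **IUTchIII:Prop3.7(iii)** (kurims p. 110) The realification of the isomorphism `(†𝓕⊛_mod)_j ⥲ (†𝓕⊛_MOD)_j`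
of Prop. 3.7 (i) on divisor monoids: it "induces the tautological isomorphism `(†𝕄⊛_mod)_α ⥲ (†𝕄⊛_MOD)_α` on the
associated rational function monoids" (p. 110), hence is the identity in the common coordinates (DEFINED as
such). [claim: Mochizuki2012, status: disputed] -/
def modToMODRlf (j : Fin (lStar l)) : D.PhiMod ≃+ PhiMODRlf D j := AddEquiv.refl _

/-- **IUTchIII:Prop3.7(iii)** (kurims p. 110) The product over `j ∈ 𝔽_l^⋇` of the divisor-level realifications
`∏_j Φ_{𝒞⊩_mod,j} ⥲ ∏_j Φ_{(†𝓕⊛ℝ_MOD)_j}` ("the composites of the isomorphisms «`†𝒞^⊩_j ⥲ (†𝓕⊛ℝ_mod)_j`» of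
[IUTchII], Corollary 4.8, (iii), with the realifications «`(†𝓕⊛ℝ_mod)_α ⥲ (†𝓕⊛ℝ_MOD)_α`»").
[claim: Mochizuki2012, status: disputed] -/
def prodModToMODRlf : (Fin (lStar l) → D.PhiMod) ≃+ (∀ j : Fin (lStar l), PhiMODRlf D j) :=
  AddEquiv.piCongrRight fun j => modToMODRlf D j

/-- **IUTchIII:Prop3.7(iii)** (kurims p. 110) **`Φ_{†𝒞^⊩_LGP}`, the divisor monoid of the global realified
LGP-Frobenioid** of the initial Θ-data: the image of `Φ_{†𝒞^⊩_gau}` (abc-iut-L6-t2 `phiGau`, [IUTchII] Cor. 4.10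
(ii)) under `prodModToMODRlf`, inside `∏_{j∈𝔽_l^⋇} Φ_{(†𝓕⊛ℝ_MOD)_j}` — "by applying the composites … to the
global realified Frobenioid portion `†𝒞^⊩_gau`". [claim: Mochizuki2012, status: disputed] -/
def phiLGP : AddSubmonoid (∀ j : Fin (lStar l), PhiMODRlf D j) :=
  (phiGau D).map (prodModToMODRlf D).toAddMonoidHom

/-- **IUTchIII:Prop3.7(iii)** (kurims p. 110) Membership in `Φ_{†𝒞^⊩_LGP}`: the weighted-diagonal shape
`(1²·φ, 2²·φ, …, (l⋆)²·φ)` of [IUTchII] Rmk. 4.5.4. [claim: Mochizuki2012, status: disputed] -/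
theorem mem_phiLGP_iff (x : ∀ j : Fin (lStar l), PhiMODRlf D j) :
    x ∈ phiLGP D ↔ ∃ φ : D.PhiMod, ∀ j : Fin (lStar l), x j = ((j.val + 1) ^ 2 : ℕ) • φ := by
  rw [← mem_weightedDiagonal_iff]
  unfold phiLGP phiGau
  rw [AddSubmonoid.mem_map]
  constructor
  · rintro ⟨y, hy, rfl⟩
    exact hy
  · intro hx
    exact ⟨x, hx, rfl⟩

/-- **IUTchIII:Prop3.7(iii)** (kurims p. 110) As a submonoid of `∏_j (V_mod →₀ ℝ≥0)`, `Φ_{†𝒞^⊩_LGP}` IS the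
weighted diagonal `Φ_{†𝒞^⊩_gau}` ((iii) re-embeds `†𝒞^⊩_gau`; nothing moves at divisor level).
[claim: Mochizuki2012, status: disputed] -/
theorem phiLGP_eq_phiGau : phiLGP D = phiGau D := by
  ext x
  rw [mem_phiLGP_iff]
  exact (mem_weightedDiagonal_iff D.PhiMod (lStar l) x).symm

/-- **IUTchIII:Prop3.7(iii)** (kurims p. 111) **The tautological isomorphism `†𝔉^⊩_gau ⥲ †𝔉^⊩_LGP` on the
global realified (divisor-monoid) portion**: `Φ_{†𝒞^⊩_gau} ⥲ Φ_{†𝒞^⊩_LGP}`, "that arises tautologically from the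
construction of `†𝔉^⊩_LGP`". [claim: Mochizuki2012, status: disputed] -/
def gauToLGP : phiGau D ≃+ phiLGP D :=
  (prodModToMODRlf D).addSubmonoidMap (phiGau D)

/-- **IUTchIII:Prop3.7(iii)** (kurims p. 111) `gauToLGP` does not move the underlying family of divisors.
[claim: Mochizuki2012, status: disputed] -/
@[simp] theorem coe_gauToLGP (x : phiGau D) :
    ((gauToLGP D x : phiLGP D) : ∀ j : Fin (lStar l), PhiMODRlf D j) = (x : Fin (lStar l) → D.PhiMod) :=
  rfl

/-- **IUTchIII:Prop3.7(iii)** (kurims pp. 110–111) The composite `Φ_{†𝒞^⊩_tht} ⥲ Φ_{†𝒞^⊩_gau} ⥲ Φ_{†𝒞^⊩_LGP}`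
of abc-iut-L6-t2's global evaluation isomorphism `thtToGau` ([IUTchII] Cor. 4.5 (v) / 4.10 (ii)) with
`gauToLGP`. [claim: Mochizuki2012, status: disputed] -/
def thtToLGP : D.PhiTht ≃+ phiLGP D := (thtToGau D).trans (gauToLGP D)

/-- **IUTchIII:Prop3.7(iii)** (kurims p. 110) The `j`-th component of `thtToLGP φ` is `j² · φ`.
[claim: Mochizuki2012, status: disputed] -/
theorem thtToLGP_apply (φ : D.PhiTht) (j : Fin (lStar l)) :
    ((thtToLGP D φ : phiLGP D) : ∀ j : Fin (lStar l), PhiMODRlf D j) j =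
      sqWeight (lStar l) j • D.modToTht.symm φ :=
  thtToGau_apply D φ j

/-- **IUTchIII:Prop3.7(iii)** (kurims p. 111) `Φ_{†𝒞^⊩_LGP} ≅ Φ_{𝒞⊩_mod} = ⊕_{v ∈ V_mod} ℝ≥0`: the divisor monoid of
`†𝒞^⊩_LGP` is a single copy of the free `ℝ≥0`-module on `V_mod` (inverse of the global evaluation isomorphism,
`l⋆ ≥ 1`). [claim: Mochizuki2012, status: disputed] -/
def phiLGPEquivPhiMod : phiLGP D ≃+ D.PhiMod :=
  (gauToLGP D).symm.trans (globalEvalIso D.PhiMod (lStar l) (lStar_pos_of_initialThetaData D)).symm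

/-- **IUTchIII:Prop3.7(iii)** (kurims p. 111) **`Prime(†𝒞^⊩_LGP) ⥲ V_mod`** ("`Prime(†𝒞^⊩_LGP) ⥲ V̲`", with
`V̲ ⥲ V_mod` of [IUTchI] Def. 3.1 (e)): the primes ([FrdI] §0) of the divisor monoid of the global realified
LGP-Frobenioid of the initial Θ-data are in canonical bijection with the valuations of `F_mod` — PROVED at the
divisor-monoid level. [claim: Mochizuki2012, status: disputed] -/
def primesLGPEquiv : Primes (Multiplicative (phiLGP D)) ≃ Val (fieldOfModuli E) :=
  (Primes.congr (phiLGPEquivPhiMod D).toMultiplicative).trans FinsuppNNReal.primesEquiv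

/-- **IUTchIII:Prop3.7(iii)** (kurims p. 111) **Compatibility with the local comparison maps** `{†ρ_{LGP,v}}`
("cf. the construction of … `†𝔉^⊩_gau` in [IUTchII], Corollary 4.10, (ii)"): the `v`-component below `w ∈ V(K)` of
the `j`-th factor of `thtToLGP φ`, read through [IUTchI] Ex. 3.5 (i)'s `ρ_w` (`InitialThetaData.rho`), is
`j² · ρ_w(φ_v)` (abc-iut-L6-t2's `rho_thtToGau` along the tautological isomorphism). [claim: Mochizuki2012, status: disputed] -/
theorem rho_thtToLGP (φ : D.PhiTht) (j : Fin (lStar l)) (w : Val K) :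
    D.rho w (((thtToLGP D φ : phiLGP D) : ∀ j : Fin (lStar l), PhiMODRlf D j) j
        (Val.restrict (fieldOfModuli E) (Val.restrict F w))) =
      ((j.val + 1) ^ 2 : ℕ) * D.rho w (D.modToTht.symm φ (Val.restrict (fieldOfModuli E) (Val.restrict F w))) :=
  rho_thtToGau D φ j w

/-- **IUTchIII:Prop3.7(v)** (kurims p. 111), restricted to (iii): the realified product embedding
`†𝒞^⊩_LGP ↪ ∏_{j∈𝔽_l^⋇} (†𝓕⊛ℝ_MOD)_j` at divisor level is the inclusion of the submonoid `Φ_{†𝒞^⊩_LGP}` — an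
embedding (injective). [claim: Mochizuki2012, status: disputed] -/
theorem embLGPDiv_injective :
    Function.Injective (fun x : phiLGP D => (x : ∀ j : Fin (lStar l), PhiMODRlf D j)) :=
  Subtype.val_injective

/-- **IUTchIII:Prop3.7(v)** (kurims p. 111), restricted to (iii): already the FIRST factor (`j = 1`, weight
`1² = 1`) of the realified product embedding determines an element of `Φ_{†𝒞^⊩_LGP}` ([IUTchII] Rmk. 4.10.3 (iii):
the label `j = 1` "may be naturally identified with the identity"). [claim: Mochizuki2012, status: disputed] -/
theorem phiLGP_ext_of_apply_zero {x y : phiLGP D}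
    (h : (x : ∀ j : Fin (lStar l), PhiMODRlf D j) ⟨0, lStar_pos_of_initialThetaData D⟩ =
      (y : ∀ j : Fin (lStar l), PhiMODRlf D j) ⟨0, lStar_pos_of_initialThetaData D⟩) : x = y := by
  obtain ⟨φ, hφ⟩ := (mem_phiLGP_iff D x).1 x.2
  obtain ⟨ψ, hψ⟩ := (mem_phiLGP_iff D y).1 y.2
  have h0φ := hφ ⟨0, lStar_pos_of_initialThetaData D⟩
  have h0ψ := hψ ⟨0, lStar_pos_of_initialThetaData D⟩
  simp only [zero_add, one_pow, one_smul] at h0φ h0ψ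
  have hφψ : φ = ψ := by rw [← h0φ, ← h0ψ, h]
  apply Subtype.ext
  funext j
  rw [hφ j, hψ j, hφψ]

/-! ### 3. Proposition 3.7 (iv): `†𝒞^⊩_lgp` and `†𝔉^⊩_gau ⥲ †𝔉^⊩_LGP ⥲ †𝔉^⊩_lgp` at divisor level -/

/-- **IUTchIII:Prop3.7(iv)** (kurims p. 111) The divisor monoid of the realification `(†𝓕⊛ℝ_𝔪𝔬𝔡)_j` of the
local-fractional-ideal Frobenioid `(†𝓕⊛_𝔪𝔬𝔡)_j` of Prop. 3.7 (ii) ([IUTchIII] Ex. 3.6 (ii), (iii)), in the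
coordinates of [IUTchI] Ex. 3.5 (i): the same free `ℝ≥0`-module on `V_mod`. [claim: Mochizuki2012, status: disputed] -/
abbrev PhiFrakRlf (_j : Fin (lStar l)) : Type u := D.PhiMod

/-- **IUTchIII:Prop3.7(iv)** (kurims p. 111) The realification of the natural isomorphism
`(†𝓕⊛_mod)_j ⥲ (†𝓕⊛_𝔪𝔬𝔡)_j` of Prop. 3.7 (ii) on divisor monoids ("induce[s] the tautological isomorphism
`(†𝕄⊛_mod)_α ⥲ (†𝕄⊛_𝔪𝔬𝔡)_α` … on the associated rational function monoids", p. 110): the identity in the common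
coordinates (DEFINED as such). [claim: Mochizuki2012, status: disputed] -/
def modToFrakRlf (j : Fin (lStar l)) : D.PhiMod ≃+ PhiFrakRlf D j := AddEquiv.refl _

/-- **IUTchIII:Prop3.7(iv)** (kurims p. 111) The product over `j ∈ 𝔽_l^⋇` of the divisor-level realifications
`∏_j Φ_{𝒞⊩_mod,j} ⥲ ∏_j Φ_{(†𝓕⊛ℝ_𝔪𝔬𝔡)_j}` ("replacing, in the construction of (iii), the isomorphisms … by the
natural isomorphisms «`(†𝓕⊛ℝ_mod)_α ⥲ (†𝓕⊛ℝ_𝔪𝔬𝔡)_α`»"). [claim: Mochizuki2012, status: disputed] -/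
def prodModToFrakRlf : (Fin (lStar l) → D.PhiMod) ≃+ (∀ j : Fin (lStar l), PhiFrakRlf D j) :=
  AddEquiv.piCongrRight fun j => modToFrakRlf D j

/-- **IUTchIII:Prop3.7(iv)** (kurims p. 111) **`Φ_{†𝒞^⊩_lgp}`, the divisor monoid of the global realified
lgp-Frobenioid** of the initial Θ-data: the image of `Φ_{†𝒞^⊩_gau}` under `prodModToFrakRlf`, inside
`∏_{j∈𝔽_l^⋇} Φ_{(†𝓕⊛ℝ_𝔪𝔬𝔡)_j}`. [claim: Mochizuki2012, status: disputed] -/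
def phiLgp : AddSubmonoid (∀ j : Fin (lStar l), PhiFrakRlf D j) :=
  (phiGau D).map (prodModToFrakRlf D).toAddMonoidHom

/-- **IUTchIII:Prop3.7(iv)** (kurims p. 111) Membership in `Φ_{†𝒞^⊩_lgp}`: the weighted-diagonal shape.
[claim: Mochizuki2012, status: disputed] -/
theorem mem_phiLgp_iff (x : ∀ j : Fin (lStar l), PhiFrakRlf D j) :
    x ∈ phiLgp D ↔ ∃ φ : D.PhiMod, ∀ j : Fin (lStar l), x j = ((j.val + 1) ^ 2 : ℕ) • φ :=
  mem_phiLGP_iff D x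

/-- **IUTchIII:Prop3.7(iv)** (kurims p. 111) At divisor level `Φ_{†𝒞^⊩_lgp}` IS `Φ_{†𝒞^⊩_LGP}` (and `Φ_{†𝒞^⊩_gau}`):
`Ψ_{𝓕_lgp} := Ψ_{𝓕_LGP}`, `†𝔉^⊢_lgp := †𝔉^⊢_LGP`, and the replaced isomorphisms are identities in coordinates.
[claim: Mochizuki2012, status: disputed] -/
theorem phiLgp_eq_phiLGP : phiLgp D = phiLGP D := rfl

/-- **IUTchIII:Prop3.7(iv)** (kurims p. 111) **The tautological isomorphism `†𝔉^⊩_LGP ⥲ †𝔉^⊩_lgp`** on the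
global realified (divisor-monoid) portion: `Φ_{†𝒞^⊩_LGP} ⥲ Φ_{†𝒞^⊩_lgp}` (undo the `MOD`-realifications, apply the
`𝔪𝔬𝔡`-realifications). [claim: Mochizuki2012, status: disputed] -/
def LGPToLgp : phiLGP D ≃+ phiLgp D :=
  (gauToLGP D).symm.trans ((prodModToFrakRlf D).addSubmonoidMap (phiGau D))

/-- **IUTchIII:Prop3.7(iv)** (kurims p. 111) `LGPToLgp` does not move the underlying family of divisors.
[claim: Mochizuki2012, status: disputed] -/
@[simp] theorem coe_LGPToLgp (x : phiLGP D) :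
    ((LGPToLgp D x : phiLgp D) : ∀ j : Fin (lStar l), PhiFrakRlf D j) =
      (x : ∀ j : Fin (lStar l), PhiMODRlf D j) := by
  rfl

/-- **IUTchIII:Prop3.7(iv)** (kurims p. 111) **The tautological isomorphisms `†𝔉^⊩_gau ⥲ †𝔉^⊩_LGP ⥲ †𝔉^⊩_lgp`**
on the global realified (divisor-monoid) portion, as one composite `Φ_{†𝒞^⊩_gau} ⥲ Φ_{†𝒞^⊩_lgp}`.
[claim: Mochizuki2012, status: disputed] -/
def gauToLgp : phiGau D ≃+ phiLgp D := (gauToLGP D).trans (LGPToLgp D)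

/-- **IUTchIII:Prop3.7(iv)** (kurims p. 111) The composite `gau ⥲ LGP ⥲ lgp` is the direct re-embedding of
`Φ_{†𝒞^⊩_gau}` into `∏_j Φ_{(†𝓕⊛ℝ_𝔪𝔬𝔡)_j}` (no divisor moves). [claim: Mochizuki2012, status: disputed] -/
@[simp] theorem coe_gauToLgp (x : phiGau D) :
    ((gauToLgp D x : phiLgp D) : ∀ j : Fin (lStar l), PhiFrakRlf D j) = (x : Fin (lStar l) → D.PhiMod) :=
  rfl

/-- **IUTchIII:Prop3.7(v)** (kurims p. 111), the VERTICAL arrow `†𝒞^⊩_LGP ⥲ †𝒞^⊩_lgp` of the commutative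
square at divisor level "arises from the second isomorphism that appears in the final display of (iv)": it
is `LGPToLgp`, and the square with the realified product embeddings (inclusions) and the product of the
realifications of `(†𝓕⊛_𝔪𝔬𝔡)_j ⥲ (†𝓕⊛_MOD)_j`⁻¹ (identities in coordinates) COMMUTES.
[claim: Mochizuki2012, status: disputed] -/
theorem realifiedSquare_commutes (x : phiLGP D) :
    ((prodModToFrakRlf D) ((prodModToMODRlf D).symm (x : ∀ j : Fin (lStar l), PhiMODRlf D j))) =
      ((LGPToLgp D x : phiLgp D) : ∀ j : Fin (lStar l), PhiFrakRlf D j) :=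
  rfl

/-- **IUTchIII:Prop3.7(iv)** (kurims p. 111) **`Prime(†𝒞^⊩_lgp) ⥲ V_mod`** (printed `Prime(†𝒞^⊩_lgp) ⥲ V̲`), at the
divisor-monoid level, transported from `primesLGPEquiv` along the tautological isomorphism.
[claim: Mochizuki2012, status: disputed] -/
def primesLgpEquiv : Primes (Multiplicative (phiLgp D)) ≃ Val (fieldOfModuli E) :=
  (Primes.congr (LGPToLgp D).symm.toMultiplicative).trans (primesLGPEquiv D)

end Prop37

end Literature.IUT.LogThetaLattice

end
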